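import Mathlib
import Summits.ValiantsHypothesis.ValiantsHypothesis.Theses.ValuativeGCT

/-!
# Stub `stub_jetRankNullity` (line `skew-restriction-rank`, crux `ValuativeGCT.ValuativeFlip`)

Powers of the vanishing ideal of the gap locus `L_U = {A | every row of A lies in U}` die under
sub-threshold jets; rank–nullity.  For a spanning family `u : Fin d → U` of `U`, the jet map `J_s`
of order `s` substitutes `X (j, i) ↦ ∑ k, u k i • x (j, k) + Y (j, i)` (tangential variables `x`,
weight `0`; normal variables `Y`, weight `1`) and keeps the weighted-homogeneous components of
`Y`-degree `≤ s`.  For every `ℂ`-subspace `W` of forms of degree `D` and every `s < t`,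
`finrank (W ⊓ P_U ^ t) + finrank (J_s W) ≤ finrank W`, where `P_U` is the vanishing ideal of `L_U`.

Proof.  (i) For `G ∈ P_U`, killing the `Y`-variables in `G (u • x + Y)` gives `G (u • x)`, which
vanishes identically (its value at any point is the value of `G` at a matrix all of whose rows lie
in `span (range u) = U`), hence is the zero polynomial (`MvPolynomial.funext`, `ℂ` infinite); so
`G (u • x + Y)` has no `Y`-free monomial.  (ii) `Y`-weights add under multiplication, so by
induction over `P_U ^ t` (`Submodule.pow_induction_on_left'`) the substitution of an element of
`P_U ^ t` has no monomial of `Y`-weight `< t`, whence all its weighted components of weight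
`≤ s < t` vanish: `P_U ^ t ≤ ker J_s`.  (iii) Rank–nullity for `J_s` restricted to `W`, which is
finite-dimensional inside `Hom_D` (`MvPolynomial.homogeneousSubmodule_fg`), and
`W ⊓ P_U ^ t ≤ W ⊓ ker J_s`.  Pure Mathlib `MvPolynomial` algebra; no cited facts.
-/

namespace Summit.ValiantsHypothesis.ValiantsHypothesis.Theorems.ValuativeFlip

open MvPolynomial
open scoped BigOperators Matrix
open Literature.NumberTheory.DiophantineGeometry
open Literature.Computability.AlgebraicComplexity

set_option linter.dupNamespace false

noncomputable section

/-! ## Weight bookkeeping for a general weight `w : ι → ℕ` -/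

/-- Weights add: if the coefficients of `F` vanish below weight `a` and those of `G` vanish below
weight `b`, then the coefficients of `F * G` vanish below weight `a + b`. -/
private theorem coeff_mul_eq_zero_of_weight_lt {ι R : Type*} [CommRing R] (w : ι → ℕ)
    {F G : MvPolynomial ι R} {a b : ℕ}
    (hF : ∀ c, Finsupp.weight w c < a → coeff c F = 0)
    (hG : ∀ c, Finsupp.weight w c < b → coeff c G = 0)
    (c : ι →₀ ℕ) (hc : Finsupp.weight w c < a + b) : coeff c (F * G) = 0 := by
  classical
  rw [coeff_mul]
  refine Finset.sum_eq_zero (fun x hx => ?_)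
  rw [Finset.HasAntidiagonal.mem_antidiagonal] at hx
  subst hx
  rw [map_add] at hc
  by_cases h1 : Finsupp.weight w x.1 < a
  · rw [hF _ h1, zero_mul]
  · rw [hG _ (by omega), mul_zero]

/-- If the coefficients of `F` vanish below weight `n`, then so does every weighted-homogeneous
component of `F` of weight `e < n`. -/
private theorem weightedHomogeneousComponent_eq_zero_of_weight_lt {ι R : Type*} [CommRing R]
    (w : ι → ℕ) {F : MvPolynomial ι R} {n e : ℕ}
    (hF : ∀ c, Finsupp.weight w c < n → coeff c F = 0) (he : e < n) :
    weightedHomogeneousComponent w e F = 0 := by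
  refine weightedHomogeneousComponent_eq_zero' e F (fun c hc => ?_)
  rintro rfl
  exact (mem_support_iff.mp hc) (hF c he)

/-- Induction over the powers of an ideal: if an algebra map `θ` sends every element of `P` to a
polynomial without monomials of weight `0`, then it sends `P ^ n` to polynomials without
monomials of weight `< n` (`Submodule.pow_induction_on_left'`; weights add). -/
private theorem coeff_map_eq_zero_of_mem_pow {ι R : Type*} [CommRing R] (w : ι → ℕ) {σ : Type*}
    (θ : MvPolynomial σ R →ₐ[R] MvPolynomial ι R) (P : Ideal (MvPolynomial σ R))
    (hP : ∀ G ∈ P, ∀ c, Finsupp.weight w c < 1 → coeff c (θ G) = 0) {n : ℕ}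
    {G : MvPolynomial σ R} (hG : G ∈ P ^ n) :
    ∀ c, Finsupp.weight w c < n → coeff c (θ G) = 0 := by
  induction hG using Submodule.pow_induction_on_left' with
  | algebraMap r => intro c hc; exact absurd hc (Nat.not_lt_zero _)
  | add x y i hx hy ihx ihy =>
    intro c hc
    rw [map_add, coeff_add, ihx c hc, ihy c hc, add_zero]
  | mem_mul x hx i y hy ih =>
    intro c hc
    rw [map_mul]
    exact coeff_mul_eq_zero_of_weight_lt w (hP x hx) ih c (by omega)

/-! ## The weight `x ↦ 0, Y ↦ 1` on a sum of variable types `α ⊕ β` -/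

/-- For the weight `x ↦ 0, Y ↦ 1` on `α ⊕ β`, a monomial has weight `0` iff it contains no
`Y`-variable (no variable indexed by `β`). -/
private theorem weight_sumElim_eq_zero_iff {α β : Type*} (c : α ⊕ β →₀ ℕ) :
    Finsupp.weight (Sum.elim (fun _ : α => (0 : ℕ)) (fun _ : β => 1)) c = 0 ↔
      ∀ b, c (Sum.inr b) = 0 := by
  rw [Finsupp.weight_apply, Finsupp.sum, Finset.sum_eq_zero_iff]
  constructor
  · intro h b
    by_contra hb
    have := h (Sum.inr b) (Finsupp.mem_support_iff.mpr hb)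
    simp only [Sum.elim_inr, smul_eq_mul, mul_one] at this
    exact hb this
  · intro h i hi
    rcases i with a | b
    · simp
    · simp [h b]

/-- Killing the `Y`-variables (`X (inl a) ↦ X (inl a)`, `X (inr b) ↦ 0`) does not change the
coefficients of the `Y`-free monomials. -/
private theorem coeff_aeval_killInr {α β R : Type*} [CommRing R] (F : MvPolynomial (α ⊕ β) R)
    (c : α ⊕ β →₀ ℕ) (hc : ∀ b, c (Sum.inr b) = 0) :
    coeff c (aeval (Sum.elim (fun a => (X (Sum.inl a) : MvPolynomial (α ⊕ β) R)) fun _ => 0) F) =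
      coeff c F := by
  classical
  induction F using MvPolynomial.induction_on' with
  | monomial v a =>
    by_cases hv : ∀ b, v (Sum.inr b) = 0
    · rw [aeval_monomial, monomial_eq, MvPolynomial.algebraMap_eq, Finsupp.prod, Finsupp.prod]
      congr 2
      refine Finset.prod_congr rfl (fun i hi => ?_)
      rcases i with a' | b
      · rfl
      · exact absurd (hv b) (Finsupp.mem_support_iff.mp hi)
    · push Not at hv
      obtain ⟨b, hb⟩ := hv
      have h0 : aeval (Sum.elim (fun a => (X (Sum.inl a) : MvPolynomial (α ⊕ β) R)) fun _ => 0)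
          (monomial v a) = 0 := by
        refine eval₂Hom_eq_zero _ _ _ (fun c' hc' => ⟨Sum.inr b, ?_, rfl⟩)
        rw [coeff_monomial] at hc'
        split_ifs at hc' with h
        · subst h; exact Finsupp.mem_support_iff.mpr hb
        · exact absurd rfl hc'
      rw [h0, coeff_zero, coeff_monomial, if_neg]
      rintro rfl
      exact hb (hc b)
  | add p q hp hq => rw [map_add, coeff_add, coeff_add, hp, hq]

/-- If killing the `Y`-variables annihilates `F`, then `F` has no `Y`-free monomial, i.e. no
monomial of weight `< 1` for the weight `x ↦ 0, Y ↦ 1`. -/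
private theorem coeff_eq_zero_of_aeval_killInr {α β R : Type*} [CommRing R]
    (F : MvPolynomial (α ⊕ β) R)
    (hF : aeval (Sum.elim (fun a => (X (Sum.inl a) : MvPolynomial (α ⊕ β) R)) fun _ => 0) F = 0)
    (c : α ⊕ β →₀ ℕ)
    (hc : Finsupp.weight (Sum.elim (fun _ : α => (0 : ℕ)) (fun _ : β => 1)) c < 1) :
    coeff c F = 0 := by
  rw [Nat.lt_one_iff, weight_sumElim_eq_zero_iff] at hc
  rw [← coeff_aeval_killInr F c hc, hF, coeff_zero]

/-! ## Step (i): the ideal of the gap locus has no `Y`-free jets -/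

/-- Step (i): substituting the displaced generic point `X (j, i) ↦ ∑ k, u k i • x (j, k) + Y (j, i)`
of the gap locus `L_U` (`U = span (range u)`) into an element `G` of the vanishing ideal of `L_U`
produces no `Y`-free monomial: killing `Y` leaves `G (u • x)`, whose value at every point is the
value of `G` at a matrix with all rows in `U`, i.e. `0`, so `G (u • x) = 0` by
`MvPolynomial.funext`. -/
private theorem coeff_jet_eq_zero_of_mem_vanishingIdeal (m d : ℕ) (u : Fin d → MatIdx m → ℂ)
    (U : Submodule ℂ (MatIdx m → ℂ)) (hU : Submodule.span ℂ (Set.range u) = U)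
    (G : MvPolynomial (MatIdx m × MatIdx m) ℂ)
    (hG : G ∈ MvPolynomial.vanishingIdeal ℂ
        {p : MatIdx m × MatIdx m → ℂ | ∀ j : MatIdx m, (fun i => p (j, i)) ∈ U})
    (c : (MatIdx m × Fin d) ⊕ (MatIdx m × MatIdx m) →₀ ℕ)
    (hc : Finsupp.weight (Sum.elim (fun _ : MatIdx m × Fin d => (0 : ℕ))
        (fun _ : MatIdx m × MatIdx m => 1)) c < 1) :
    coeff c ((MvPolynomial.aeval (R := ℂ) fun p : MatIdx m × MatIdx m =>
        (∑ k : Fin d, u k p.2 • MvPolynomial.X (Sum.inl (p.1, k))) +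
          MvPolynomial.X (Sum.inr p) :
      MvPolynomial (MatIdx m × MatIdx m) ℂ →ₐ[ℂ]
        MvPolynomial ((MatIdx m × Fin d) ⊕ (MatIdx m × MatIdx m)) ℂ) G) = 0 := by
  refine coeff_eq_zero_of_aeval_killInr _ ?_ c hc
  rw [comp_aeval_apply]
  simp only [map_add, map_sum, map_smul, aeval_X, Sum.elim_inl, Sum.elim_inr, add_zero]
  refine MvPolynomial.funext (fun x => ?_)
  rw [map_zero]
  change aeval x _ = 0
  rw [comp_aeval_apply]
  refine (mem_vanishingIdeal_iff.mp hG) _ (fun j => ?_)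
  simp only [map_sum, map_smul, aeval_X, smul_eq_mul]
  have : (fun i => ∑ k : Fin d, u k i * x (Sum.inl (j, k))) =
      ∑ k : Fin d, x (Sum.inl (j, k)) • u k := by
    ext i
    simp only [Finset.sum_apply, Pi.smul_apply, smul_eq_mul, mul_comm]
  rw [this, ← hU]
  exact Submodule.sum_mem _ (fun k _ =>
    Submodule.smul_mem _ _ (Submodule.subset_span (Set.mem_range_self k)))

/-! ## The stub -/

/-- **Stub 2 of the line `skew-restriction-rank` — the hinge: powers of the ideal of the gap
locus die under sub-threshold jets; rank–nullity.**  For a spanning family `u : Fin d → U` of the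
row space `U`, the jet map `J` of order `s` substitutes the generic point of
`L_U = {A | every row ∈ U}` displaced by a full matrix of normal variables,
`X (j, i) ↦ ∑ k, u k i • x (j, k) + Y (j, i)`, and keeps the components of `Y`-degree `≤ s`
(`weightedHomogeneousComponent` for the weight `x ↦ 0, Y ↦ 1`).  For every subspace `W` of forms
of degree `D` and every `s < t`:  `finrank (W ⊓ P_U ^ t) + finrank (J W) ≤ finrank W`, `P_U` the
vanishing ideal of `L_U`.  Proof: `P_U ^ t ≤ ker J` (steps (i)–(ii) of the module docstring:
`coeff_jet_eq_zero_of_mem_vanishingIdeal`, `coeff_map_eq_zero_of_mem_pow`,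
`weightedHomogeneousComponent_eq_zero_of_weight_lt`), then rank–nullity
(`LinearMap.finrank_range_add_finrank_ker`) for `J` restricted to the finite-dimensional `W`. -/
theorem stub_jetRankNullity (m d : ℕ) (u : Fin d → MatIdx m → ℂ) (U : Submodule ℂ (MatIdx m → ℂ))
    (hU : Submodule.span ℂ (Set.range u) = U) (D t s : ℕ) (hst : s < t)
    (W : Submodule ℂ (MvPolynomial (MatIdx m × MatIdx m) ℂ))
    (hW : W ≤ MvPolynomial.homogeneousSubmodule (MatIdx m × MatIdx m) ℂ D) :
    let J : MvPolynomial (MatIdx m × MatIdx m) ℂ →ₗ[ℂ]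
        MvPolynomial ((MatIdx m × Fin d) ⊕ (MatIdx m × MatIdx m)) ℂ :=
      (∑ e ∈ Finset.range (s + 1),
          MvPolynomial.weightedHomogeneousComponent
            (Sum.elim (fun _ => 0) (fun _ => 1) : (MatIdx m × Fin d) ⊕ (MatIdx m × MatIdx m) → ℕ) e) ∘ₗ
        (MvPolynomial.aeval (R := ℂ) fun p : MatIdx m × MatIdx m =>
            (∑ k : Fin d, u k p.2 • MvPolynomial.X (Sum.inl (p.1, k))) +
              MvPolynomial.X (Sum.inr p)).toLinearMap
    Module.finrank ℂ ↥(W ⊓ ((MvPolynomial.vanishingIdeal ℂ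
        {p : MatIdx m × MatIdx m → ℂ | ∀ j : MatIdx m, (fun i => p (j, i)) ∈ U}) ^ t).restrictScalars ℂ) +
      Module.finrank ℂ ↥(W.map J) ≤ Module.finrank ℂ ↥W := by
  intro J
  set θ : MvPolynomial (MatIdx m × MatIdx m) ℂ →ₐ[ℂ]
      MvPolynomial ((MatIdx m × Fin d) ⊕ (MatIdx m × MatIdx m)) ℂ :=
    (MvPolynomial.aeval (R := ℂ) fun p : MatIdx m × MatIdx m =>
      (∑ k : Fin d, u k p.2 • MvPolynomial.X (Sum.inl (p.1, k))) +
        MvPolynomial.X (Sum.inr p))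
  set P : Ideal (MvPolynomial (MatIdx m × MatIdx m) ℂ) := MvPolynomial.vanishingIdeal ℂ
    {p : MatIdx m × MatIdx m → ℂ | ∀ j : MatIdx m, (fun i => p (j, i)) ∈ U}
  set w : (MatIdx m × Fin d) ⊕ (MatIdx m × MatIdx m) → ℕ :=
    Sum.elim (fun _ => 0) (fun _ => 1)
  -- (i) + (ii): `P ^ t ≤ ker J`
  have hker : ∀ G ∈ P ^ t, J G = 0 := by
    intro G hG
    have hc : ∀ c, Finsupp.weight w c < t → coeff c (θ G) = 0 :=
      coeff_map_eq_zero_of_mem_pow w θ P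
        (fun G' hG' => coeff_jet_eq_zero_of_mem_vanishingIdeal m d u U hU G' hG') hG
    show (∑ e ∈ Finset.range (s + 1), weightedHomogeneousComponent w e) (θ G) = 0
    rw [LinearMap.coe_sum, Finset.sum_apply]
    refine Finset.sum_eq_zero (fun e he => ?_)
    rw [Finset.mem_range] at he
    exact weightedHomogeneousComponent_eq_zero_of_weight_lt w hc (by omega)
  -- (iii): rank–nullity for `J` restricted to the finite-dimensional `W ≤ Hom_D`
  haveI : Module.Finite ℂ ↥(MvPolynomial.homogeneousSubmodule (MatIdx m × MatIdx m) ℂ D) :=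
    Module.Finite.iff_fg.mpr (MvPolynomial.homogeneousSubmodule_fg _ ℂ D)
  haveI : FiniteDimensional ℂ ↥W := Submodule.finiteDimensional_of_le hW
  have hrn := LinearMap.finrank_range_add_finrank_ker (J.domRestrict W)
  rw [LinearMap.range_domRestrict, LinearMap.ker_domRestrict] at hrn
  have hle : (W ⊓ (P ^ t).restrictScalars ℂ).comap W.subtype ≤
      (LinearMap.ker J).comap W.subtype := by
    intro x hx
    simp only [Submodule.mem_comap, Submodule.mem_inf, Submodule.restrictScalars_mem,
      LinearMap.mem_ker] at hx ⊢
    exact hker _ hx.2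
  have h1 := Submodule.finrank_mono hle
  have h2 := (Submodule.comapSubtypeEquivOfLe
    (inf_le_left : W ⊓ (P ^ t).restrictScalars ℂ ≤ W)).finrank_eq
  omega

end

end Summit.ValiantsHypothesis.ValiantsHypothesis.Theorems.ValuativeFlip
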